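import Summits.AtomisticToContinuum.HydrodynamicLimit.Theorems.TwoClocksEquilibriumFastWindowLDBirthT12GainRadialGeneralB
import Literature.Analysis.UnboundedOperators.LinearizedBoltzmannGaussGrowth
import HarnessLib

/-!
# (e-K₂) for GENERAL radial test functions, III: the Carleman slice representation under GAUSSIAN growth
# and the one-dimensional shifts in a general weight class
# (helper `t12_gainTerm_radial_slice_gauss` of the line `birth`, crux `TwoClocks.EquilibriumFastWindowLD`,
# stmt-AtomisticToContinuum-14440; infrastructure (e-K₂), `ℓ = 0` bootstrap, towards the registered analytic
# sub-goal `t12_logLinearPreimage_and_dipoleModulus`, plan §5)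

Continuation of `…T12GainRadialGeneral(B)` (Carleman slice representation and (e-K₂) comparison for `G` of LINEAR
growth). The `ℓ = 0` bootstrap of the corrector analysis runs the Euler–Volterra lemma on the zonal profile at its
CURRENT a-priori growth — quadratic-log `(1 + t²)(1 + log(1 + t²))` (`t12_logQuadraticPreimage_of_quadraticData`), then
log-linear `(1 + t)(1 + log(1 + t))`, then linear — and each round consumes the comparison
`gainTerm (G ∘ ‖·‖) v - lorentzGain (G ∘ ‖·‖) v` for `G` measurable in that class. This file supplies the two
growth-insensitive ingredients; the comparison itself is `…T12GainRadialGrowthB`.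

* **The slice representation under GAUSSIAN growth** (registered `t12_gainTerm_radial_slice_gauss`;
  `gainTerm_radial_eq_slice_gauss`): for `G` measurable with `|G t| ≤ C e^{t²/4}` on `[0, ∞)` — the maximal growth of
  the tree's pointwise theory of `L` (`kernelAction_eq_pieces_of_gaussGrowth`), containing every polynomial /
  logarithmic class — and `S = ‖v‖`, `γ = gaussianReal 0 1`,
  `gainTerm (G ∘ ‖·‖) v = 4π ∫ γ(dt) J(t)`, `J(t) := ∫_{-1}^{1} (S x - t)₊ G(√(S² - (S x)² + t²)) dx`, and
  `gainTerm - lorentzGain = 4π ∫ γ(dt) (J(t) - J(0))` (`lorentzGain_radial_eq_slice`: the Lorentz operator is the slice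
  `t = 0`). The proof is that of `t12_gainTerm_radial_slice` — exchange symmetry (`gainFst_eq_gainSnd`), Carleman's
  slice `((v-w)·ω)₊ = (a - t)₊`, `‖v'‖² = S² - a² + t²` with `a = ⟪v, ω⟫`, `t = ⟪w, ω⟫ ∼ γ` under `M` for every `ω`
  (`stdGaussian_map_inner_sphere`), hat-box `a = S x` — the only new point being the domination
  `|(a - t)₊ G(√(S² - a² + t²))| ≤ C(1 + S)e^{S²/4} · (1 + |t|)e^{t²/4}` (`abs_slice_integrand_le_gauss`), integrable on
  `σ ⊗ γ` since `(1 + |t|)e^{t²/4} ∈ L¹(γ)` (`integrable_one_add_abs_mul_exp_gaussianReal`, the projection of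
  `(1 + ‖w‖)e^{‖w‖²/4} ∈ L¹(M)`, `integrable_one_add_norm_mul_exp_sq_div_four_stdGaussian`) and on `M ⊗ σ` by the latter.
* **The weight class** of the comparison: `W : ℝ → ℝ` nondecreasing and `≥ 1` on `[0, ∞)` with the POLYNOMIAL
  INCREMENT `W(s + t) ≤ W(s)(1 + t)ⁿ` (`s, t ≥ 0`), and `|G t| ≤ m W(t)` on `[0, ∞)` (`1 + t`: `n = 1`; log-linear:
  `n = 2`; quadratic-log: `n = 4`; `(1 + t)ᵏ`: `n = k`). Such `G` has Gaussian growth (`gaussGrowth_of_weightGrowth`: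
  `W(t) ≤ W(0)(1 + t)ⁿ ≤ W(0)e^{nt} ≤ W(0)e^{n²}e^{t²/4}`), size `|G(√(S² - a² + t²))| ≤ m W(S + |t|) ≤ m W(S)(1 + |t|)ⁿ` on
  the slice (`abs_comp_sqrt_le_weight`), `G ∘ √·` interval integrable (`intervalIntegrable_comp_sqrt_weight`), and the
  flux shift `|∫_{-1}^{1} ((Sx - t)₊ - (Sx)₊) G(√(S² - (Sx)² + t²)) dx| ≤ 2|t| m W(S + |t|)` (`abs_integral_fluxShift_le_weight`,
  `x ↦ x₊` is `1`-Lipschitz).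

[folklore] (Carleman 1933 / Hilbert 1912 representation of the hard-sphere gain term; Grad 1963 §4;
Cercignani–Illner–Pulvirenti 1994 §7.2; (e-K₂) of the corrector-growth plan of the line `birth`).
-/

noncomputable section

open MeasureTheory ProbabilityTheory Real Set Filter Metric
open scoped ENNReal BigOperators InnerProductSpace
namespace Summit.AtomisticToContinuum.HydrodynamicLimit.Theorems.ClampedCorrectorBirth

open Literature.Analysis.FluidPDE Literature.MathematicalPhysics.KineticTheory
open Literature.Analysis.UnboundedOperators Literature.Probability.Distributions

variable {G W : ℝ → ℝ} {C m : ℝ} {n : ℕ} {v : EuclideanSpace ℝ (Fin 3)}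

/-! ### Gaussian growth: domination of the slice integrand and integrability on the two product spaces -/

/-- **`(1 + |t|) e^{t²/4} ∈ L¹(γ)`**, `γ = gaussianReal 0 1`: the projection `t = ⟪w, ω⟫` of `M = stdGaussian ℝ³`
is `γ` (`stdGaussian_map_inner_sphere`) and `(1 + |⟪w, ω⟫|) e^{⟪w, ω⟫²/4} ≤ (1 + ‖w‖) e^{‖w‖²/4} ∈ L¹(M)`
(`integrable_one_add_norm_mul_exp_sq_div_four_stdGaussian`). [folklore] -/
theorem integrable_one_add_abs_mul_exp_gaussianReal :
    Integrable (fun t : ℝ => (1 + |t|) * Real.exp (t ^ 2 / 4)) (gaussianReal 0 1) := by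
  set ω : sphere (0 : EuclideanSpace ℝ (Fin 3)) 1 := ⟨EuclideanSpace.single 0 1, by simp⟩
  rw [← stdGaussian_map_inner_sphere ω]
  refine (integrable_map_measure (Continuous.aestronglyMeasurable (by fun_prop)) (by fun_prop)).2 ?_
  refine (integrable_one_add_norm_mul_exp_sq_div_four_stdGaussian (E := EuclideanSpace ℝ (Fin 3))).mono'
    (Continuous.aestronglyMeasurable (by fun_prop)) (Eventually.of_forall fun w => ?_)
  have ht : |⟪w, (ω : EuclideanSpace ℝ (Fin 3))⟫_ℝ| ≤ ‖w‖ := by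
    have h := abs_real_inner_le_norm w (ω : EuclideanSpace ℝ (Fin 3))
    rwa [norm_eq_of_mem_sphere, mul_one] at h
  have ht2 : ⟪w, (ω : EuclideanSpace ℝ (Fin 3))⟫_ℝ ^ 2 ≤ ‖w‖ ^ 2 := by
    rw [← sq_abs]; exact pow_le_pow_left₀ (abs_nonneg _) ht 2
  simp only [Function.comp_apply, Real.norm_eq_abs]
  rw [abs_of_nonneg (by positivity)]
  gcongr

/-- Gaussian growth `|G t| ≤ C e^{t²/4}` on `[0, ∞)` forces `0 ≤ C`. [folklore] -/
theorem nonneg_of_gaussGrowth (hC : ∀ t : ℝ, 0 ≤ t → |G t| ≤ C * Real.exp (t ^ 2 / 4)) : 0 ≤ C := by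
  have h := hC 0 le_rfl
  simp only [ne_eq, OfNat.ofNat_ne_zero, not_false_eq_true, zero_pow, zero_div, Real.exp_zero, mul_one] at h
  exact (abs_nonneg _).trans h

/-- **The slice integrand is dominated** under Gaussian growth: for `|a| ≤ S`,
`|(a - t)₊ G(√(S² - a² + t²))| ≤ C (1 + S) e^{S²/4} · (1 + |t|) e^{t²/4}` (`(a - t)₊ ≤ (1 + S)(1 + |t|)`,
`S² - a² + t² ≤ S² + t²`). [folklore] -/
theorem abs_slice_integrand_le_gauss (hC : ∀ t : ℝ, 0 ≤ t → |G t| ≤ C * Real.exp (t ^ 2 / 4)) {S a : ℝ}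
    (hS : 0 ≤ S) (ha : |a| ≤ S) (t : ℝ) :
    |max (a - t) 0 * G (√(S ^ 2 - a ^ 2 + t ^ 2))| ≤
      C * (1 + S) * Real.exp (S ^ 2 / 4) * ((1 + |t|) * Real.exp (t ^ 2 / 4)) := by
  have hC0 := nonneg_of_gaussGrowth hC
  have h1 : max (a - t) 0 ≤ (1 + S) * (1 + |t|) :=
    max_le (by nlinarith [le_abs_self a, neg_abs_le t, abs_nonneg t]) (by positivity)
  have harg : 0 ≤ S ^ 2 - a ^ 2 + t ^ 2 := by nlinarith [abs_nonneg a, sq_abs a, sq_nonneg t]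
  have h2 : |G (√(S ^ 2 - a ^ 2 + t ^ 2))| ≤ C * (Real.exp (S ^ 2 / 4) * Real.exp (t ^ 2 / 4)) := by
    refine (hC _ (sqrt_nonneg _)).trans (mul_le_mul_of_nonneg_left ?_ hC0)
    rw [Real.sq_sqrt harg, ← Real.exp_add]
    exact Real.exp_le_exp.2 (by nlinarith [sq_nonneg a])
  rw [abs_mul, abs_of_nonneg (le_max_right _ _)]
  calc max (a - t) 0 * |G (√(S ^ 2 - a ^ 2 + t ^ 2))|
      ≤ ((1 + S) * (1 + |t|)) * (C * (Real.exp (S ^ 2 / 4) * Real.exp (t ^ 2 / 4))) :=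
        mul_le_mul h1 h2 (abs_nonneg _) (by positivity)
    _ = C * (1 + S) * Real.exp (S ^ 2 / 4) * ((1 + |t|) * Real.exp (t ^ 2 / 4)) := by ring

/-- **Integrability of the own-particle integrand on `M ⊗ σ`** under Gaussian growth:
`(w, ω) ↦ ((v - w)·ω)₊ G(‖v'‖)` is dominated by `C (1 + ‖v‖) e^{‖v‖²/4} · (1 + ‖w‖) e^{‖w‖²/4}` (`|⟪w, ω⟫| ≤ ‖w‖`).
[folklore] -/
theorem integrable_gainFst_radial_prod_gauss (hG : Measurable G)
    (hC : ∀ t : ℝ, 0 ≤ t → |G t| ≤ C * Real.exp (t ^ 2 / 4)) (v : EuclideanSpace ℝ (Fin 3)) :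
    Integrable (Function.uncurry fun (w : EuclideanSpace ℝ (Fin 3)) (ω : sphere (0 : EuclideanSpace ℝ (Fin 3)) 1) =>
        hardSphereKernel (v, w) ω * G ‖(collide ω (v, w)).1‖)
      ((stdGaussian (EuclideanSpace ℝ (Fin 3))).prod (sphereMeasure : Measure (sphere (0 : EuclideanSpace ℝ (Fin 3)) 1))) := by
  haveI := isFiniteMeasure_sphereMeasure (E := EuclideanSpace ℝ (Fin 3))
  have hC0 := nonneg_of_gaussGrowth hC
  have hφ : Integrable (fun w : EuclideanSpace ℝ (Fin 3) =>
      C * (1 + ‖v‖) * Real.exp (‖v‖ ^ 2 / 4) * ((1 + ‖w‖) * Real.exp (‖w‖ ^ 2 / 4)))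
      (stdGaussian (EuclideanSpace ℝ (Fin 3))) :=
    (integrable_one_add_norm_mul_exp_sq_div_four_stdGaussian (E := EuclideanSpace ℝ (Fin 3))).const_mul _
  have hB : Continuous fun p : EuclideanSpace ℝ (Fin 3) × sphere (0 : EuclideanSpace ℝ (Fin 3)) 1 =>
      hardSphereKernel (v, p.1) p.2 := by
    unfold hardSphereKernel; fun_prop
  have hP : Continuous fun p : EuclideanSpace ℝ (Fin 3) × sphere (0 : EuclideanSpace ℝ (Fin 3)) 1 =>
      (collide p.2 (v, p.1)).1 := by
    unfold collide; fun_prop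
  refine (hφ.mul_prod (integrable_const (1:ℝ))).mono'
    (hB.measurable.mul (hG.comp hP.norm.measurable)).aestronglyMeasurable (Eventually.of_forall fun p => ?_)
  rcases p with ⟨w, ω⟩
  simp only [Function.uncurry_apply_pair, mul_one, Real.norm_eq_abs]
  have ha : |⟪v, (ω : EuclideanSpace ℝ (Fin 3))⟫_ℝ| ≤ ‖v‖ := by
    have h := abs_real_inner_le_norm v (ω : EuclideanSpace ℝ (Fin 3))
    rwa [norm_eq_of_mem_sphere, mul_one] at h
  have ht : |⟪w, (ω : EuclideanSpace ℝ (Fin 3))⟫_ℝ| ≤ ‖w‖ := by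
    have h := abs_real_inner_le_norm w (ω : EuclideanSpace ℝ (Fin 3))
    rwa [norm_eq_of_mem_sphere, mul_one] at h
  have ht2 : ⟪w, (ω : EuclideanSpace ℝ (Fin 3))⟫_ℝ ^ 2 ≤ ‖w‖ ^ 2 := by
    rw [← sq_abs]; exact pow_le_pow_left₀ (abs_nonneg _) ht 2
  rw [hardSphereKernel_mul_comp_norm_collide_fst]
  refine (abs_slice_integrand_le_gauss hC (norm_nonneg v) ha _).trans ?_
  gcongr

/-- **Integrability of the slice integrand on `σ ⊗ γ`** under Gaussian growth:
`(ω, t) ↦ (⟪v, ω⟫ - t)₊ G(√(‖v‖² - ⟪v, ω⟫² + t²))` is dominated by `C (1 + ‖v‖) e^{‖v‖²/4} · (1 + |t|) e^{t²/4}`.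
[folklore] -/
theorem integrable_slice_prod_gauss (hG : Measurable G)
    (hC : ∀ t : ℝ, 0 ≤ t → |G t| ≤ C * Real.exp (t ^ 2 / 4)) (v : EuclideanSpace ℝ (Fin 3)) :
    Integrable (Function.uncurry fun (ω : sphere (0 : EuclideanSpace ℝ (Fin 3)) 1) (t : ℝ) =>
        max (⟪v, (ω : EuclideanSpace ℝ (Fin 3))⟫_ℝ - t) 0 *
          G (√(‖v‖ ^ 2 - ⟪v, (ω : EuclideanSpace ℝ (Fin 3))⟫_ℝ ^ 2 + t ^ 2)))
      ((sphereMeasure : Measure (sphere (0 : EuclideanSpace ℝ (Fin 3)) 1)).prod (gaussianReal 0 1)) := by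
  haveI := isFiniteMeasure_sphereMeasure (E := EuclideanSpace ℝ (Fin 3))
  have hψ : Integrable (fun t : ℝ => C * (1 + ‖v‖) * Real.exp (‖v‖ ^ 2 / 4) * ((1 + |t|) * Real.exp (t ^ 2 / 4)))
      (gaussianReal 0 1) := integrable_one_add_abs_mul_exp_gaussianReal.const_mul _
  have hmeas : Measurable (Function.uncurry fun (ω : sphere (0 : EuclideanSpace ℝ (Fin 3)) 1) (t : ℝ) =>
      max (⟪v, (ω : EuclideanSpace ℝ (Fin 3))⟫_ℝ - t) 0 *
        G (√(‖v‖ ^ 2 - ⟪v, (ω : EuclideanSpace ℝ (Fin 3))⟫_ℝ ^ 2 + t ^ 2))) := by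
    refine Measurable.mul (by fun_prop) (hG.comp ?_)
    fun_prop
  refine ((integrable_const (1:ℝ)).mul_prod hψ).mono' hmeas.aestronglyMeasurable (Eventually.of_forall fun p => ?_)
  rcases p with ⟨ω, t⟩
  simp only [Function.uncurry_apply_pair, one_mul, Real.norm_eq_abs]
  have ha : |⟪v, (ω : EuclideanSpace ℝ (Fin 3))⟫_ℝ| ≤ ‖v‖ := by
    have h := abs_real_inner_le_norm v (ω : EuclideanSpace ℝ (Fin 3))
    rwa [norm_eq_of_mem_sphere, mul_one] at h
  exact abs_slice_integrand_le_gauss hC (norm_nonneg v) ha t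

/-! ### The exact slice representation under Gaussian growth -/

/-- **The own piece in slice form** under Gaussian growth:
`∫ dM(w) ∫_{S²} ((v - w)·ω)₊ G(‖v'‖) dσ(ω) = 2π ∫ J(t) dγ(t)` (Fubini on `M ⊗ σ`, the Gaussian projection
`t = ⟪w, ω⟫ ∼ γ`, Fubini on `σ ⊗ γ`, hat-box), as in `gainFst_radial_eq_slice`. [folklore] -/
theorem gainFst_radial_eq_slice_gauss (hG : Measurable G)
    (hC : ∀ t : ℝ, 0 ≤ t → |G t| ≤ C * Real.exp (t ^ 2 / 4)) (v : EuclideanSpace ℝ (Fin 3)) :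
    ∫ w, ∫ ω, hardSphereKernel (v, w) ω * G ‖(collide ω (v, w)).1‖ ∂sphereMeasure
        ∂stdGaussian (EuclideanSpace ℝ (Fin 3)) =
      2 * π * ∫ t, (∫ x in (-1:ℝ)..1, max (‖v‖ * x - t) 0 * G (√(‖v‖ ^ 2 - (‖v‖ * x) ^ 2 + t ^ 2))) ∂gaussianReal 0 1 := by
  haveI := isFiniteMeasure_sphereMeasure (E := EuclideanSpace ℝ (Fin 3))
  obtain ⟨n, hn, hvn⟩ := exists_unit_inner_eq v
  calc ∫ w, ∫ ω, hardSphereKernel (v, w) ω * G ‖(collide ω (v, w)).1‖ ∂sphereMeasure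
          ∂stdGaussian (EuclideanSpace ℝ (Fin 3))
      = ∫ ω, ∫ w, hardSphereKernel (v, w) ω * G ‖(collide ω (v, w)).1‖ ∂stdGaussian (EuclideanSpace ℝ (Fin 3))
          ∂sphereMeasure := integral_integral_swap (integrable_gainFst_radial_prod_gauss hG hC v)
    _ = ∫ ω : sphere (0 : EuclideanSpace ℝ (Fin 3)) 1, ∫ t,
          max (⟪v, (ω : EuclideanSpace ℝ (Fin 3))⟫_ℝ - t) 0 *
            G (√(‖v‖ ^ 2 - ⟪v, (ω : EuclideanSpace ℝ (Fin 3))⟫_ℝ ^ 2 + t ^ 2)) ∂gaussianReal 0 1 ∂sphereMeasure := by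
        refine integral_congr_ae (Eventually.of_forall fun ω => ?_)
        dsimp only
        simp_rw [hardSphereKernel_mul_comp_norm_collide_fst]
        exact integral_stdGaussian_comp_inner_sphere ω
          (h := fun t => max (⟪v, (ω : EuclideanSpace ℝ (Fin 3))⟫_ℝ - t) 0 *
            G (√(‖v‖ ^ 2 - ⟪v, (ω : EuclideanSpace ℝ (Fin 3))⟫_ℝ ^ 2 + t ^ 2))) (by fun_prop)
    _ = ∫ t, ∫ ω : sphere (0 : EuclideanSpace ℝ (Fin 3)) 1,
          max (⟪v, (ω : EuclideanSpace ℝ (Fin 3))⟫_ℝ - t) 0 *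
            G (√(‖v‖ ^ 2 - ⟪v, (ω : EuclideanSpace ℝ (Fin 3))⟫_ℝ ^ 2 + t ^ 2)) ∂sphereMeasure ∂gaussianReal 0 1 :=
        integral_integral_swap (integrable_slice_prod_gauss hG hC v)
    _ = ∫ t, 2 * π * (∫ x in (-1:ℝ)..1, max (‖v‖ * x - t) 0 * G (√(‖v‖ ^ 2 - (‖v‖ * x) ^ 2 + t ^ 2))) ∂gaussianReal 0 1 :=
        integral_congr_ae (Eventually.of_forall fun t => sphereIntegral_slice_eq hG hn hvn t)
    _ = 2 * π * ∫ t, (∫ x in (-1:ℝ)..1, max (‖v‖ * x - t) 0 * G (√(‖v‖ ^ 2 - (‖v‖ * x) ^ 2 + t ^ 2))) ∂gaussianReal 0 1 := integral_const_mul _ _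

/-- **The radial slice is `γ`-integrable** under Gaussian growth. [folklore] -/
theorem integrable_slice_gauss (hG : Measurable G)
    (hC : ∀ t : ℝ, 0 ≤ t → |G t| ≤ C * Real.exp (t ^ 2 / 4)) (v : EuclideanSpace ℝ (Fin 3)) :
    Integrable (fun t => ∫ x in (-1:ℝ)..1, max (‖v‖ * x - t) 0 * G (√(‖v‖ ^ 2 - (‖v‖ * x) ^ 2 + t ^ 2))) (gaussianReal 0 1) := by
  haveI := isFiniteMeasure_sphereMeasure (E := EuclideanSpace ℝ (Fin 3))
  obtain ⟨n, hn, hvn⟩ := exists_unit_inner_eq v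
  have h := ((integrable_slice_prod_gauss hG hC v).integral_prod_right).congr
    (Eventually.of_forall fun t => sphereIntegral_slice_eq hG hn hvn t)
  refine (h.const_mul (2 * π)⁻¹).congr (Eventually.of_forall fun t => ?_)
  dsimp only
  rw [← mul_assoc, inv_mul_cancel₀ (by positivity), one_mul]

/-- **The gain term and the (e-K₂) difference in slice form** under Gaussian growth:
`gainTerm (G ∘ ‖·‖) v = 4π ∫ J(t) dγ(t)` (exchange symmetry: twice the own piece) and
`gainTerm (G ∘ ‖·‖) v - lorentzGain (G ∘ ‖·‖) v = 4π ∫ (J(t) - J(0)) dγ(t)` (the Lorentz operator is the slice `t = 0`,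
`lorentzGain_radial_eq_slice`). [folklore] -/
theorem gainTerm_radial_eq_slice_gauss (hG : Measurable G)
    (hC : ∀ t : ℝ, 0 ≤ t → |G t| ≤ C * Real.exp (t ^ 2 / 4)) (v : EuclideanSpace ℝ (Fin 3)) :
    gainTerm (fun x => G ‖x‖) v = 4 * π * ∫ t, (∫ x in (-1:ℝ)..1, max (‖v‖ * x - t) 0 *
        G (√(‖v‖ ^ 2 - (‖v‖ * x) ^ 2 + t ^ 2))) ∂gaussianReal 0 1 ∧
      gainTerm (fun x => G ‖x‖) v - lorentzGain (fun x => G ‖x‖) v =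
        4 * π * ∫ t, ((∫ x in (-1:ℝ)..1, max (‖v‖ * x - t) 0 * G (√(‖v‖ ^ 2 - (‖v‖ * x) ^ 2 + t ^ 2))) -
          ∫ x in (-1:ℝ)..1, max (‖v‖ * x) 0 * G (√(‖v‖ ^ 2 - (‖v‖ * x) ^ 2))) ∂gaussianReal 0 1 := by
  have hu : Measurable fun x : EuclideanSpace ℝ (Fin 3) => G ‖x‖ := hG.comp measurable_norm
  have h2 : ∫ w, ∫ ω, hardSphereKernel (v, w) ω * G ‖(collide ω (v, w)).2‖ ∂sphereMeasure
        ∂stdGaussian (EuclideanSpace ℝ (Fin 3)) =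
      ∫ w, ∫ ω, hardSphereKernel (v, w) ω * G ‖(collide ω (v, w)).1‖ ∂sphereMeasure
        ∂stdGaussian (EuclideanSpace ℝ (Fin 3)) :=
    integral_congr_ae (Eventually.of_forall fun w => (gainFst_eq_gainSnd v w hu).symm)
  have hgain : gainTerm (fun x => G ‖x‖) v = 4 * π * ∫ t, (∫ x in (-1:ℝ)..1, max (‖v‖ * x - t) 0 *
      G (√(‖v‖ ^ 2 - (‖v‖ * x) ^ 2 + t ^ 2))) ∂gaussianReal 0 1 := by
    simp only [gainTerm]
    rw [h2, gainFst_radial_eq_slice_gauss hG hC v]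
    ring
  refine ⟨hgain, ?_⟩
  rw [hgain, lorentzGain_radial_eq_slice hG v,
    integral_sub (integrable_slice_gauss hG hC v) (integrable_const _), integral_const, probReal_univ, one_smul]
  ring

/-! ### The weight class: size of `G` on a slice, Gaussian growth, flux shift -/

section WeightClass

variable (hW : (∀ a b : ℝ, 0 ≤ a → a ≤ b → W a ≤ W b) ∧ (∀ a : ℝ, 0 ≤ a → 1 ≤ W a) ∧
    ∀ s t : ℝ, 0 ≤ s → 0 ≤ t → W (s + t) ≤ W s * (1 + t) ^ n)
  (hGw : ∀ t : ℝ, 0 ≤ t → |G t| ≤ m * W t)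
include hW hGw

/-- In the weight class (`W ≥ 1` nondecreasing on `[0, ∞)` with `W(s + t) ≤ W(s)(1 + t)ⁿ`; `|G| ≤ m W` there),
`|G 0| ≤ m W(0)` forces `0 ≤ m`. [folklore] -/
theorem nonneg_of_weightGrowth : 0 ≤ m := by
  have h1 : (1:ℝ) ≤ W 0 := hW.2.1 0 le_rfl
  have h2 : |G 0| ≤ m * W 0 := hGw 0 le_rfl
  rcases le_or_gt 0 m with h | h
  · exact h
  · have h3 : m * W 0 ≤ m * 1 := mul_le_mul_of_nonpos_left h1 h.le
    linarith [abs_nonneg (G 0)]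

/-- **Size of `G` on the slice** in the weight class: `|G(√(S² - a² + t²))| ≤ m W(S + |t|) ≤ m W(S) (1 + |t|)ⁿ`
(`0 ≤ S`; `√(S² - a² + t²) ≤ S + |t|`, `W` nondecreasing of polynomial increment). [folklore] -/
theorem abs_comp_sqrt_le_weight {S : ℝ} (hS : 0 ≤ S) (a t : ℝ) :
    |G (√(S ^ 2 - a ^ 2 + t ^ 2))| ≤ m * W (S + |t|) ∧ m * W (S + |t|) ≤ m * (W S * (1 + |t|) ^ n) := by
  have hm0 := nonneg_of_weightGrowth hW hGw
  exact ⟨(hGw _ (sqrt_nonneg _)).trans (mul_le_mul_of_nonneg_left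
      (hW.1 _ _ (sqrt_nonneg _) (sqrt_sq_sub_sq_add_sq_le hS a t)) hm0),
    mul_le_mul_of_nonneg_left (hW.2.2 S |t| hS (abs_nonneg t)) hm0⟩

/-- **The weight class has Gaussian growth**: `|G t| ≤ m W(0) e^{n²} · e^{t²/4}` on `[0, ∞)`
(`W(t) ≤ W(0)(1 + t)ⁿ ≤ W(0) e^{nt}` and `nt ≤ n² + t²/4`), so that the slice representation
`gainTerm_radial_eq_slice_gauss` applies. [folklore] -/
theorem gaussGrowth_of_weightGrowth (t : ℝ) (ht : 0 ≤ t) :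
    |G t| ≤ m * W 0 * Real.exp ((n : ℝ) ^ 2) * Real.exp (t ^ 2 / 4) := by
  have hm0 := nonneg_of_weightGrowth hW hGw
  have hW0 : 0 ≤ W 0 := zero_le_one.trans (hW.2.1 0 le_rfl)
  have h1 : W t ≤ W 0 * (1 + t) ^ n := by simpa using hW.2.2 0 t le_rfl ht
  have h2 : (1 + t) ^ n ≤ Real.exp ((n : ℝ) ^ 2) * Real.exp (t ^ 2 / 4) := by
    rw [← Real.exp_add]
    calc (1 + t) ^ n ≤ Real.exp t ^ n :=
          pow_le_pow_left₀ (by positivity) (by linarith [Real.add_one_le_exp t]) n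
      _ = Real.exp (n * t) := (Real.exp_nat_mul t n).symm
      _ ≤ Real.exp ((n : ℝ) ^ 2 + t ^ 2 / 4) := Real.exp_le_exp.2 (by nlinarith [sq_nonneg ((n : ℝ) - t / 2)])
  calc |G t| ≤ m * W t := hGw t ht
    _ ≤ m * (W 0 * (Real.exp ((n : ℝ) ^ 2) * Real.exp (t ^ 2 / 4))) :=
        mul_le_mul_of_nonneg_left (h1.trans (mul_le_mul_of_nonneg_left h2 hW0)) hm0
    _ = m * W 0 * Real.exp ((n : ℝ) ^ 2) * Real.exp (t ^ 2 / 4) := by ring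

/-- **The flux shift** in the weight class:
`|∫_{-1}^{1} ((S x - t)₊ - (S x)₊) G(√(S² - (S x)² + t²)) dx| ≤ 2 |t| m W(S + |t|)` (`x ↦ x₊` is `1`-Lipschitz).
[folklore] -/
theorem abs_integral_fluxShift_le_weight {S : ℝ} (hS : 0 ≤ S) (t : ℝ) :
    |∫ x in (-1:ℝ)..1, (max (S * x - t) 0 - max (S * x) 0) * G (√(S ^ 2 - (S * x) ^ 2 + t ^ 2))| ≤
      2 * (|t| * (m * W (S + |t|))) := by
  have h := intervalIntegral.norm_integral_le_of_norm_le_const (a := (-1:ℝ)) (b := 1)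
    (C := |t| * (m * W (S + |t|)))
    (f := fun x => (max (S * x - t) 0 - max (S * x) 0) * G (√(S ^ 2 - (S * x) ^ 2 + t ^ 2))) fun x _ => by
      rw [Real.norm_eq_abs, abs_mul]
      refine mul_le_mul ?_ (abs_comp_sqrt_le_weight hW hGw hS (S * x) t).1 (abs_nonneg _) (abs_nonneg _)
      have h := abs_max_sub_max_le_abs (S * x - t) (S * x) 0
      rwa [show S * x - t - S * x = -t by ring, abs_neg] at h
  rw [Real.norm_eq_abs] at h
  refine h.trans (le_of_eq ?_)
  norm_num
  ring

variable (hG : Measurable G)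
include hG

/-- `y ↦ G(√y)` is interval integrable on every `[a, b]` in the weight class (`|G(√y)| ≤ m W(√(|a| + |b|))` there).
[folklore] -/
theorem intervalIntegrable_comp_sqrt_weight (a b : ℝ) : IntervalIntegrable (fun y => G (√y)) volume a b := by
  have hm0 := nonneg_of_weightGrowth hW hGw
  refine intervalIntegrable_of_abs_le (by fun_prop) (C := m * W (√(|a| + |b|))) fun y hy => ?_
  have hy' : y ≤ |a| + |b| := by
    rcases mem_uIoc.1 hy with h | h
    · exact h.2.trans ((le_abs_self b).trans (by linarith [abs_nonneg a]))
    · exact h.2.trans ((le_abs_self a).trans (by linarith [abs_nonneg b]))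
  exact (hGw _ (sqrt_nonneg y)).trans (mul_le_mul_of_nonneg_left
    (hW.1 _ _ (sqrt_nonneg y) (Real.sqrt_le_sqrt hy')) hm0)

end WeightClass

/-! ### Registered helper -/

/-- **Registered helper `t12_gainTerm_radial_slice_gauss` — the exact one-dimensional (Carleman slice)
representation of the true gain term on a radial test function of GAUSSIAN growth.** For `G : ℝ → ℝ` measurable
with `|G t| ≤ C e^{t²/4}` for `t ≥ 0` — the maximal growth of the tree's pointwise theory of `L`
(`kernelAction_eq_pieces_of_gaussGrowth`), containing every polynomial / logarithmic weight class met by the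
`ℓ = 0` bootstrap (`gaussGrowth_of_weightGrowth`) — and every `v ∈ ℝ³` (`M = stdGaussian`, `σ` the surface
measure of `S²`, `(v', w') = collide ω (v, w)`, `γ = gaussianReal 0 1`, `S = ‖v‖`):
`∫ dM(w) ∫_{S²} ((v-w)·ω)₊ G(‖v'‖) dσ(ω) + ∫ dM(w) ∫_{S²} ((v-w)·ω)₊ G(‖w'‖) dσ(ω)`
`= 4π ∫ γ(dt) ∫_{-1}^{1} (S x - t)₊ G(√(S² - (S x)² + t²)) dx`,
i.e. `gainTerm (G ∘ ‖·‖) v = 4π ∫ J(t) dγ(t)`; with `lorentzGain (G ∘ ‖·‖) v = 4π J(0)` (`lorentzGain_radial_eq_slice`)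
the (e-K₂) comparison for any such `G` is the one-dimensional `4π ∫ γ(dt)(J(t) - J(0))`
(`gainTerm_radial_eq_slice_gauss`). Extends `t12_gainTerm_radial_slice` (linear growth) verbatim: exchange
symmetry (`gainFst_eq_gainSnd`), Carleman's slice `(u·ω)₊ = (a - t)₊`, `‖v'‖² = S² - a² + t²` (`a = ⟪v, ω⟫`,
`t = ⟪w, ω⟫ ∼ γ` under `M` for every `ω`), hat-box `a = S x`; the only new point is the domination
`|(a - t)₊ G(√(S² - a² + t²))| ≤ C(1 + S)e^{S²/4} · (1 + |t|)e^{t²/4} ∈ L¹(σ ⊗ γ)` resp. `· (1 + ‖w‖)e^{‖w‖²/4} ∈ L¹(M ⊗ σ)`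
making both Fubini exchanges legitimate. [folklore] -/
theorem t12_gainTerm_radial_slice_gauss : ∀ (G : ℝ → ℝ) (C : ℝ), Measurable G → (∀ t : ℝ, 0 ≤ t → |G t| ≤ C * Real.exp (t ^ 2 / 4)) → ∀ v : EuclideanSpace ℝ (Fin 3), (∫ w, ∫ ω, Literature.MathematicalPhysics.KineticTheory.hardSphereKernel (v, w) ω * G ‖(Literature.MathematicalPhysics.KineticTheory.collide ω (v, w)).1‖ ∂Literature.MathematicalPhysics.KineticTheory.sphereMeasure ∂ProbabilityTheory.stdGaussian (EuclideanSpace ℝ (Fin 3))) + (∫ w, ∫ ω, Literature.MathematicalPhysics.KineticTheory.hardSphereKernel (v, w) ω * G ‖(Literature.MathematicalPhysics.KineticTheory.collide ω (v, w)).2‖ ∂Literature.MathematicalPhysics.KineticTheory.sphereMeasure ∂ProbabilityTheory.stdGaussian (EuclideanSpace ℝ (Fin 3))) = 4 * Real.pi * ∫ t, (∫ x in (-1:ℝ)..1, max (‖v‖ * x - t) 0 * G (Real.sqrt (‖v‖ ^ 2 - (‖v‖ * x) ^ 2 + t ^ 2))) ∂ProbabilityTheory.gaussianReal 0 1 :=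
  fun _ _ hG hC v => (gainTerm_radial_eq_slice_gauss hG hC v).1

end Summit.AtomisticToContinuum.HydrodynamicLimit.Theorems.ClampedCorrectorBirth

end
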